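import Literature.Computability.QuantumComplexity.ZOmegaCodesFP
import Literature.Computability.QuantumComplexity.ZWRing
import Literature.Computability.Complexity.IntMatrixBricks
import HarnessLib

/-!
# `ℤ[ω]` codes in the `FP` string algebra, II: product, conjugation, exact division, tests, saturation

Topic `Literature/Computability/QuantumComplexity`, continuing `ZOmegaCodesFP.lean` (`ZWCode.enc`,
the total decoder `ZWCode.dec`, `mk4`/`rec4`, `zwCanonF`, `zwAddF`, `mulOmegaF`, `zwPowF`, the sign test
`posTestF`, `length_enc_le`) with the bricks that the ring structure of `ZWRing.lean` (`ZW.mul`,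
`ZW.cconj`, `ZW.divPow`) calls for. The state-vector DP of `StateVectorDP.lean` only adds and rotates
amplitudes; the reduced-state (Gram) data of the `p`-blocked simulation of Jozsa–Linden
(`Literature/Barriers/QuantumAdvantage/BoundedEntanglement*.lean`: merge = product then exact division
by `2^h`, gate = conjugation `V D V†`, split test = equality of products) need general products,
complex conjugates, exact halving, equality tests and — to stay polynomial on malformed inputs —
saturation of coordinates at a width. As in part I every brick is a TOTAL string function with a
closed-form value through `dec`, is in `FP`, and emits canonical codes:

* `fld k` (the four coordinate fields, `ival (fld k u) = dec u k`), `zwSubF`, `zwNegF`;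
* **`zwMulF ⟨u, v⟩ = enc (ZW.mul (dec u) (dec v))`** (sixteen `zmulF`), `zwConjF u = enc (cconj (dec u))`;
* `zwDivF ⟨d, u⟩ = enc (k ↦ dec u k / ival d)` (`Int.ediv` coordinatewise; `= enc (divPow h (dec u))`
  when `ival d = 2^h`, `zwDivF_boolPair_of_ival_eq`);
* one-bit tests `zwIsZeroT u = [dec u = 0]`, `zwEqT ⟨u, v⟩ = [dec u = dec v]`;
* saturation `zwCapF ⟨x, u⟩` (each coordinate through `zcapF` at width `|x|`), with
  `length_zwCapF_boolPair_le : |zwCapF ⟨x, u⟩| ≤ 14|x| + 20` on every input and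
  `zwCapF_boolPair_of_lt` (no effect on small coordinates).

## References

* S. Arora, B. Barak, *Computational Complexity: A Modern Approach*, CUP 2009, §1.3.
* D. E. Knuth, *The Art of Computer Programming*, Vol. 2, 3rd ed., 1998, §4.3.1, §4.6.4.
* R. Jozsa, N. Linden, Proc. R. Soc. Lond. A 459 (2003), §3, lemma `ratlemma` and proof of lemma
  `ratpbl` (exact arithmetic in a finite extension of `ℚ`) — the consumer.
-/

noncomputable section

namespace Literature.Computability.QuantumComplexity

namespace ZWCode

open _root_.Computability Complexity Complexity.Brick ZW

/-! ### The coordinate fields -/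

/-- The four coordinate fields of a record: fields `0, 1, 2` and the bare last field. [folklore] -/
def fld : Fin 4 → (List Bool → List Bool)
  | 0 => nthF 0
  | 1 => nthF 1
  | 2 => nthF 2
  | 3 => sndPow 2

/-- `fld k ∈ FP`. [folklore] -/
theorem fld_mem_FP (k : Fin 4) : fld k ∈ FP := by
  fin_cases k
  · exact nthF_mem_FP 0
  · exact nthF_mem_FP 1
  · exact nthF_mem_FP 2
  · exact sndPow_mem_FP 2

/-- The fields read the coordinates of the decoded value. [folklore] -/
@[simp] theorem ival_fld (k : Fin 4) (u : List Bool) : ival (fld k u) = dec u k := by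
  fin_cases k <;> simp [fld, dec]

/-- The fields of a code. [folklore] -/
@[simp] theorem fld_enc (k : Fin 4) (a : ZW) : fld k (enc a) = dpEnc (a k) := by
  fin_cases k <;> simp [fld, enc, rec4, nthF, sndPow, Function.comp_def]

/-- A record of four canonical integer codes is the code of its values. [folklore] -/
theorem rec4_dpEnc (a b c d : ℤ) : rec4 (dpEnc a) (dpEnc b) (dpEnc c) (dpEnc d) = enc ![a, b, c, d] := by
  simp [enc]

/-! ### Subtraction and negation -/

/-- Coordinate `k` of both operands of `⟨u, v⟩`, combined by the integer brick `op`. [folklore] -/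
def coordOp (op : List Bool → List Bool) (k : Fin 4) : List Bool → List Bool :=
  op ∘ fanoutFn (fld k ∘ fstF) (fld k ∘ sndF)

/-- `coordOp` on a pair. [folklore] -/
@[simp] theorem coordOp_boolPair (op : List Bool → List Bool) (k : Fin 4) (u v : List Bool) :
    coordOp op k (boolPair u v) = op (boolPair (fld k u) (fld k v)) := by
  simp [coordOp]

/-- `coordOp op k ∈ FP` for `op ∈ FP`. [folklore] -/
theorem coordOp_mem_FP {op : List Bool → List Bool} (hop : op ∈ FP) (k : Fin 4) : coordOp op k ∈ FP :=
  comp_mem_FP hop (fanoutFn_mem_FP (comp_mem_FP (fld_mem_FP k) fstF_mem_FP) (comp_mem_FP (fld_mem_FP k) sndF_mem_FP))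

/-- **Subtraction** `zwSubF ⟨u, v⟩ = enc (dec u - dec v)`. [cite: KnuthTAOCP2, §4.3.1] -/
def zwSubF : List Bool → List Bool :=
  mk4 (coordOp zsubF 0) (coordOp zsubF 1) (coordOp zsubF 2) (coordOp zsubF 3)

/-- Value of `zwSubF`. [folklore] -/
@[simp] theorem zwSubF_boolPair (u v : List Bool) : zwSubF (boolPair u v) = enc (dec u - dec v) := by
  rw [zwSubF, mk4_apply]
  simp only [coordOp_boolPair, zsubF_boolPair, ival_fld]
  rw [rec4_dpEnc]
  congr 1
  funext k
  fin_cases k <;> simp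

/-- `zwSubF ∈ FP`. [folklore] -/
theorem zwSubF_mem_FP : zwSubF ∈ FP :=
  mk4_mem_FP (coordOp_mem_FP zsubF_mem_FP 0) (coordOp_mem_FP zsubF_mem_FP 1) (coordOp_mem_FP zsubF_mem_FP 2)
    (coordOp_mem_FP zsubF_mem_FP 3)

/-- **Negation** `zwNegF u = enc (-dec u)`. [folklore] -/
def zwNegF : List Bool → List Bool :=
  mk4 (znegF ∘ fld 0) (znegF ∘ fld 1) (znegF ∘ fld 2) (znegF ∘ fld 3)

/-- Value of `zwNegF`. [folklore] -/
@[simp] theorem zwNegF_apply (u : List Bool) : zwNegF u = enc (-dec u) := by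
  rw [zwNegF, mk4_apply]
  simp only [Function.comp_apply, znegF_eq, ival_fld]
  rw [rec4_dpEnc]
  congr 1
  funext k
  fin_cases k <;> simp

/-- `zwNegF ∈ FP`. [folklore] -/
theorem zwNegF_mem_FP : zwNegF ∈ FP :=
  mk4_mem_FP (comp_mem_FP znegF_mem_FP (fld_mem_FP 0)) (comp_mem_FP znegF_mem_FP (fld_mem_FP 1))
    (comp_mem_FP znegF_mem_FP (fld_mem_FP 2)) (comp_mem_FP znegF_mem_FP (fld_mem_FP 3))

/-! ### Multiplication -/

/-- The product of coordinate `i` of the first and coordinate `j` of the second operand. [folklore] -/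
def mF (i j : Fin 4) : List Bool → List Bool :=
  zmulF ∘ fanoutFn (fld i ∘ fstF) (fld j ∘ sndF)

/-- Value of `mF`. [folklore] -/
@[simp] theorem mF_boolPair (i j : Fin 4) (u v : List Bool) : mF i j (boolPair u v) = dpEnc (dec u i * dec v j) := by
  simp [mF]

/-- `mF i j ∈ FP`. [folklore] -/
theorem mF_mem_FP (i j : Fin 4) : mF i j ∈ FP :=
  comp_mem_FP zmulF_mem_FP (fanoutFn_mem_FP (comp_mem_FP (fld_mem_FP i) fstF_mem_FP) (comp_mem_FP (fld_mem_FP j) sndF_mem_FP))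

/-- Sum of two integer-valued bricks. [folklore] -/
def plusF (f g : List Bool → List Bool) : List Bool → List Bool := zaddF ∘ fanoutFn f g
/-- Difference of two integer-valued bricks. [folklore] -/
def minusF (f g : List Bool → List Bool) : List Bool → List Bool := zsubF ∘ fanoutFn f g

/-- Value of `plusF`. [folklore] -/
@[simp] theorem plusF_apply (f g : List Bool → List Bool) (w : List Bool) :
    plusF f g w = dpEnc (ival (f w) + ival (g w)) := by
  simp [plusF]

/-- Value of `minusF`. [folklore] -/
@[simp] theorem minusF_apply (f g : List Bool → List Bool) (w : List Bool) :
    minusF f g w = dpEnc (ival (f w) - ival (g w)) := by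
  simp [minusF]

/-- `plusF f g ∈ FP`. [folklore] -/
theorem plusF_mem_FP {f g : List Bool → List Bool} (hf : f ∈ FP) (hg : g ∈ FP) : plusF f g ∈ FP :=
  comp_mem_FP zaddF_mem_FP (fanoutFn_mem_FP hf hg)

/-- `minusF f g ∈ FP`. [folklore] -/
theorem minusF_mem_FP {f g : List Bool → List Bool} (hf : f ∈ FP) (hg : g ∈ FP) : minusF f g ∈ FP :=
  comp_mem_FP zsubF_mem_FP (fanoutFn_mem_FP hf hg)

/-- Coordinate `0` of the product: `z₀w₀ - z₁w₃ - z₂w₂ - z₃w₁`. [folklore] -/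
def mul0F : List Bool → List Bool := minusF (minusF (minusF (mF 0 0) (mF 1 3)) (mF 2 2)) (mF 3 1)
/-- Coordinate `1` of the product: `z₀w₁ + z₁w₀ - z₂w₃ - z₃w₂`. [folklore] -/
def mul1F : List Bool → List Bool := minusF (minusF (plusF (mF 0 1) (mF 1 0)) (mF 2 3)) (mF 3 2)
/-- Coordinate `2` of the product: `z₀w₂ + z₁w₁ + z₂w₀ - z₃w₃`. [folklore] -/
def mul2F : List Bool → List Bool := minusF (plusF (plusF (mF 0 2) (mF 1 1)) (mF 2 0)) (mF 3 3)
/-- Coordinate `3` of the product: `z₀w₃ + z₁w₂ + z₂w₁ + z₃w₀`. [folklore] -/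
def mul3F : List Bool → List Bool := plusF (plusF (plusF (mF 0 3) (mF 1 2)) (mF 2 1)) (mF 3 0)

/-- **Multiplication** `zwMulF ⟨u, v⟩ = enc (ZW.mul (dec u) (dec v))` (the convolution with `ω⁴ = -1`
of `ZW.mul`, sixteen integer products). [cite: KnuthTAOCP2, §4.6.4] -/
def zwMulF : List Bool → List Bool := mk4 mul0F mul1F mul2F mul3F

/-- Value of `zwMulF`. [folklore] -/
@[simp] theorem zwMulF_boolPair (u v : List Bool) : zwMulF (boolPair u v) = enc (ZW.mul (dec u) (dec v)) := by
  rw [zwMulF, mk4_apply]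
  simp only [mul0F, mul1F, mul2F, mul3F, minusF_apply, plusF_apply, mF_boolPair, ival_dpEnc]
  rw [rec4_dpEnc]
  congr 1

/-- `zwMulF ∈ FP`. [folklore] -/
theorem zwMulF_mem_FP : zwMulF ∈ FP :=
  mk4_mem_FP
    (minusF_mem_FP (minusF_mem_FP (minusF_mem_FP (mF_mem_FP 0 0) (mF_mem_FP 1 3)) (mF_mem_FP 2 2)) (mF_mem_FP 3 1))
    (minusF_mem_FP (minusF_mem_FP (plusF_mem_FP (mF_mem_FP 0 1) (mF_mem_FP 1 0)) (mF_mem_FP 2 3)) (mF_mem_FP 3 2))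
    (minusF_mem_FP (plusF_mem_FP (plusF_mem_FP (mF_mem_FP 0 2) (mF_mem_FP 1 1)) (mF_mem_FP 2 0)) (mF_mem_FP 3 3))
    (plusF_mem_FP (plusF_mem_FP (plusF_mem_FP (mF_mem_FP 0 3) (mF_mem_FP 1 2)) (mF_mem_FP 2 1)) (mF_mem_FP 3 0))

/-! ### Complex conjugation -/

/-- **Complex conjugation** `zwConjF u = enc (cconj (dec u))` (`(z₀, -z₃, -z₂, -z₁)`; `conj ω = -ω³`).
[folklore] -/
def zwConjF : List Bool → List Bool :=
  mk4 (zcanonF ∘ fld 0) (znegF ∘ fld 3) (znegF ∘ fld 2) (znegF ∘ fld 1)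

/-- Value of `zwConjF`. [folklore] -/
@[simp] theorem zwConjF_apply (u : List Bool) : zwConjF u = enc (cconj (dec u)) := by
  rw [zwConjF, mk4_apply]
  simp only [Function.comp_apply, zcanonF_eq, znegF_eq, ival_fld]
  rw [rec4_dpEnc]
  congr 1

/-- `zwConjF ∈ FP`. [folklore] -/
theorem zwConjF_mem_FP : zwConjF ∈ FP :=
  mk4_mem_FP (comp_mem_FP zcanonF_mem_FP (fld_mem_FP 0)) (comp_mem_FP znegF_mem_FP (fld_mem_FP 3))
    (comp_mem_FP znegF_mem_FP (fld_mem_FP 2)) (comp_mem_FP znegF_mem_FP (fld_mem_FP 1))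

/-! ### Exact division by an integer -/

/-- Coordinate `k` of the second component divided by the first component. [folklore] -/
def divCoordF (k : Fin 4) : List Bool → List Bool :=
  zedivF ∘ fanoutFn (zcanonF ∘ fld k ∘ sndF) (zcanonF ∘ fstF)

/-- Value of `divCoordF`. [folklore] -/
@[simp] theorem divCoordF_boolPair (k : Fin 4) (d u : List Bool) :
    divCoordF k (boolPair d u) = dpEnc (dec u k / ival d) := by
  simp only [divCoordF, Function.comp_apply, fanoutFn_apply, sndF_boolPair, fstF_boolPair, zcanonF_eq, zedivF_dpEnc,
    ival_fld]

/-- `divCoordF k ∈ FP`. [folklore] -/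
theorem divCoordF_mem_FP (k : Fin 4) : divCoordF k ∈ FP :=
  comp_mem_FP zedivF_mem_FP (fanoutFn_mem_FP
    (comp_mem_FP zcanonF_mem_FP (comp_mem_FP (fld_mem_FP k) sndF_mem_FP)) (comp_mem_FP zcanonF_mem_FP fstF_mem_FP))

/-- **Coordinatewise division** `zwDivF ⟨d, u⟩ = enc (k ↦ dec u k / ival d)` (`Int.ediv`; exact on
multiples, which is how the merge step of the `p`-blocked simulation divides by `2^h`).
[cite: JozsaLinden2003, §3 (proof of lemma ratpbl, Case 2)] -/
def zwDivF : List Bool → List Bool := mk4 (divCoordF 0) (divCoordF 1) (divCoordF 2) (divCoordF 3)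

/-- Value of `zwDivF`. [folklore] -/
@[simp] theorem zwDivF_boolPair (d u : List Bool) : zwDivF (boolPair d u) = enc (fun k => dec u k / ival d) := by
  rw [zwDivF, mk4_apply]
  simp only [divCoordF_boolPair]
  rw [rec4_dpEnc]
  congr 1
  funext k
  fin_cases k <;> simp

/-- With `ival d = 2^h`, `zwDivF` is `ZW.divPow h`. [cite: JozsaLinden2003, §3 (proof of lemma ratpbl, Case 2)] -/
theorem zwDivF_boolPair_of_ival_eq (h : ℕ) {d : List Bool} (hd : ival d = 2 ^ h) (u : List Bool) :
    zwDivF (boolPair d u) = enc (divPow h (dec u)) := by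
  rw [zwDivF_boolPair, hd]
  rfl

/-- `zwDivF ∈ FP`. [folklore] -/
theorem zwDivF_mem_FP : zwDivF ∈ FP :=
  mk4_mem_FP (divCoordF_mem_FP 0) (divCoordF_mem_FP 1) (divCoordF_mem_FP 2) (divCoordF_mem_FP 3)

/-! ### Tests -/

/-- **Zero test** `zwIsZeroT u = [dec u = 0]` (all four coordinates vanish). [folklore] -/
def zwIsZeroT : List Bool → List Bool :=
  andFn (isZeroFn ∘ fld 0) (andFn (isZeroFn ∘ fld 1) (andFn (isZeroFn ∘ fld 2) (isZeroFn ∘ fld 3)))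

/-- Value of `zwIsZeroT`. [folklore] -/
@[simp] theorem zwIsZeroT_apply (u : List Bool) : zwIsZeroT u = [decide (dec u = 0)] := by
  have h0 : (isZeroFn ∘ fld 0) u = [decide (ival (fld 0 u) = 0)] := isZeroFn_apply _
  have h1 : (isZeroFn ∘ fld 1) u = [decide (ival (fld 1 u) = 0)] := isZeroFn_apply _
  have h2 : (isZeroFn ∘ fld 2) u = [decide (ival (fld 2 u) = 0)] := isZeroFn_apply _
  have h3 : (isZeroFn ∘ fld 3) u = [decide (ival (fld 3 u) = 0)] := isZeroFn_apply _
  rw [zwIsZeroT, andFn_apply h0 (andFn_apply h1 (andFn_apply h2 h3))]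
  simp only [ival_fld]
  congr 1
  rw [← Bool.decide_and, ← Bool.decide_and, ← Bool.decide_and, decide_eq_decide]
  constructor
  · rintro ⟨e0, e1, e2, e3⟩
    funext k
    fin_cases k
    · exact e0
    · exact e1
    · exact e2
    · exact e3
  · intro h
    exact ⟨congrFun h 0, congrFun h 1, congrFun h 2, congrFun h 3⟩

/-- `zwIsZeroT` is one-bit. [folklore] -/
theorem oneBit_zwIsZeroT : OneBit zwIsZeroT := fun u => ⟨_, zwIsZeroT_apply u⟩

/-- `zwIsZeroT ∈ FP`. [folklore] -/
theorem zwIsZeroT_mem_FP : zwIsZeroT ∈ FP :=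
  andFn_mem_FP (comp_mem_FP isZeroFn_mem_FP (fld_mem_FP 0)) (andFn_mem_FP (comp_mem_FP isZeroFn_mem_FP (fld_mem_FP 1))
    (andFn_mem_FP (comp_mem_FP isZeroFn_mem_FP (fld_mem_FP 2)) (comp_mem_FP isZeroFn_mem_FP (fld_mem_FP 3))))

/-- **Equality test** `zwEqT ⟨u, v⟩ = [dec u = dec v]`. [folklore] -/
def zwEqT : List Bool → List Bool := zwIsZeroT ∘ zwSubF

/-- Value of `zwEqT`. [folklore] -/
@[simp] theorem zwEqT_boolPair (u v : List Bool) : zwEqT (boolPair u v) = [decide (dec u = dec v)] := by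
  rw [zwEqT, Function.comp_apply, zwSubF_boolPair, zwIsZeroT_apply, dec_enc]
  congr 1
  exact decide_eq_decide.2 sub_eq_zero

/-- `zwEqT` is one-bit. [folklore] -/
theorem oneBit_zwEqT : OneBit zwEqT := oneBit_zwIsZeroT.comp _

/-- `zwEqT ∈ FP`. [folklore] -/
theorem zwEqT_mem_FP : zwEqT ∈ FP := comp_mem_FP zwIsZeroT_mem_FP zwSubF_mem_FP

/-! ### Saturation at a width -/

/-- Coordinate `k` of the second component saturated at the width of the first. [folklore] -/
def capCoordF (k : Fin 4) : List Bool → List Bool :=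
  zcapF ∘ fanoutFn fstF (zcanonF ∘ fld k ∘ sndF)

/-- Value of `capCoordF`. [folklore] -/
@[simp] theorem capCoordF_boolPair (k : Fin 4) (x u : List Bool) :
    capCoordF k (boolPair x u) = dpEnc (if (dec u k).natAbs < 2 ^ x.length then dec u k else 0) := by
  simp only [capCoordF, Function.comp_apply, fanoutFn_apply, sndF_boolPair, fstF_boolPair, zcanonF_eq, zcapF_dpEnc,
    ival_fld]

/-- `capCoordF k ∈ FP`. [folklore] -/
theorem capCoordF_mem_FP (k : Fin 4) : capCoordF k ∈ FP :=
  comp_mem_FP zcapF_mem_FP (fanoutFn_mem_FP fstF_mem_FP (comp_mem_FP zcanonF_mem_FP (comp_mem_FP (fld_mem_FP k) sndF_mem_FP)))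

/-- `|capCoordF k ⟨x, u⟩| ≤ 2|x| + 2` on every input. [folklore] -/
theorem length_capCoordF_boolPair_le (k : Fin 4) (x u : List Bool) : (capCoordF k (boolPair x u)).length ≤ 2 * x.length + 2 := by
  have := length_zcapF_le (fanoutFn fstF (zcanonF ∘ fld k ∘ sndF) (boolPair x u))
  simp only [capCoordF, Function.comp_apply, fanoutFn_apply, fstF_boolPair] at this ⊢
  exact this

/-- **Saturation** `zwCapF ⟨x, u⟩`: every coordinate of absolute value `≥ 2^{|x|}` is replaced by `0`
(the others are kept): how a machine keeps its `ℤ[ω]` registers within a width on malformed inputs.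
[folklore] -/
def zwCapF : List Bool → List Bool := mk4 (capCoordF 0) (capCoordF 1) (capCoordF 2) (capCoordF 3)

/-- Value of `zwCapF`. [folklore] -/
@[simp] theorem zwCapF_boolPair (x u : List Bool) :
    zwCapF (boolPair x u) = enc (fun k => if (dec u k).natAbs < 2 ^ x.length then dec u k else 0) := by
  rw [zwCapF, mk4_apply]
  simp only [capCoordF_boolPair]
  rw [rec4_dpEnc]
  congr 1
  funext k
  fin_cases k <;> simp

/-- Saturation does nothing to small coordinates. [folklore] -/
theorem zwCapF_boolPair_of_lt (x u : List Bool) (h : ∀ k, (dec u k).natAbs < 2 ^ x.length) :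
    zwCapF (boolPair x u) = enc (dec u) := by
  rw [zwCapF_boolPair]
  congr 1
  funext k
  rw [if_pos (h k)]

/-- `zwCapF ∈ FP`. [folklore] -/
theorem zwCapF_mem_FP : zwCapF ∈ FP :=
  mk4_mem_FP (capCoordF_mem_FP 0) (capCoordF_mem_FP 1) (capCoordF_mem_FP 2) (capCoordF_mem_FP 3)

/-- **`|zwCapF ⟨x, u⟩| ≤ 14|x| + 20` on every input.** [folklore] -/
theorem length_zwCapF_boolPair_le (x u : List Bool) : (zwCapF (boolPair x u)).length ≤ 14 * x.length + 20 := by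
  rw [zwCapF, mk4_apply, length_rec4]
  have h0 := length_capCoordF_boolPair_le 0 x u
  have h1 := length_capCoordF_boolPair_le 1 x u
  have h2 := length_capCoordF_boolPair_le 2 x u
  have h3 := length_capCoordF_boolPair_le 3 x u
  omega

end ZWCode

end Literature.Computability.QuantumComplexity

end
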